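import Summits.Ventures.CertifiedManyBodySolver.Observables.TISourcedClusterNodeFloorsW5
import Summits.Ventures.CertifiedManyBodySolver.Observables.TISourcedClusterTrialRowsTwoIntervals
import HarnessLib

/-!
# Reading ONE certified sourced cluster state at EVERY pinning field: the open-box energy is affine in `h`,
# so a certificate that prints the state's energy at its run field `h` AND at field `0` caps the canonical
# sourced energy at every `h′` — field transport on the PRODUCER side, exact

Cell hubbard-cq (rung CQ, CQ-TABLE §B1-U; row «h-chord transport nodes», seat hubbard-cq-obsth-2). The W5 certificates
of sr-mbsolver-var-10 (FORMAT-mpsgf1) evaluate ONE integer MPS `ψ` of the open pair-sourced `a × b` box EXACTLY: besides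
`E = ⟨ψ, A_C(μ₀, h)ψ⟩` and `⟨N⟩` (the two rows of the landed claim node `cert_sgf_openbox16x4_…`, p472075) the certificate
carries the exact pair-source expectation `X` and the exact source-free energy `⟨H_Hub − μ₀N⟩ = E + κX` (cert fields
`observables.X_pair_gsum`, `hubbard_energy_per_site_no_source_no_mu`). Since
`A_C(μ, h) = hamiltonianWith − h·(P_C + P_Cᴴ)` is AFFINE in `h` (`dWaveSourceOpenBox_field_affine`:
`A_C(h′) = A_C(0) + r·(A_C(h) − A_C(0))` for `h′ = r·h`), the same vector read at any other field `h′` has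
`Re⟨ψ, A_C(h′)ψ⟩ = (1 − r)·Re⟨ψ, A_C(0)ψ⟩ + r·Re⟨ψ, A_C(h)ψ⟩` (`re_expect_dWaveSourceOpenBox_field`), hence an exact
energy CAP at `h′` from the cap at `h` and a ONE-SIDED bound at field `0`: the UPPER end `e0hi` when reading DOWN
(`0 ≤ r ≤ 1`, interpolation, `clusterCap_field_down`) and the LOWER end `e0lo` when reading UP (`1 ≤ r`, extrapolation,
`clusterCap_field_up`). §3 packages this for a TWO-FIELD CLAIM NODE — the v1 node with two trailing conjuncts
`e0lo·(ab) ≤ Re⟨ψ, A_C(μ₀,0)ψ⟩ ∧ Re⟨ψ, A_C(μ₀,0)ψ⟩ ≤ e0hi·(ab)` (proposed to var-10 for the `32 × 4` nodes and as a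
supplementary node for the `16 × 4` certificate) — returning the STANDARD five-conjunct node at the new field
(`clusterNode_at_field_down/up_of_twoFieldNode`), so every existing consumer (p2's two-box bridge, p6's interval rows,
obsth-2's `minimiser_response_floor_of_clusterNodeInterval_of_clusterNode` / `…_of_two_clusterNodeIntervals`, pin-1's
`sourcedEnergyUpperRow_of_exists_clusterState`, obsth-3's GC tangent readers) applies VERBATIM at `h′`; §4 is the
canonical minimiser floor at the new field in one statement.

PLANNING [float, on var-10's exact 16 × 4 certificate values `e_Ψ(0.30305) = −0.9385647`, `X/ab = 0.7423428`,
`n = 0.8565043`, read with pilot-1's refereed `4 × 3` partners]: the ONE landed W5 state read at `h_tree = 0.35355 / 0.40406 /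
0.60609 / 0.80812` gives canonical chord floors `m(7/8; h) ≥ 0.122 / 0.178 / 0.286 / 0.351` against the table of record
`0.0277821 / 0.0882348 / 0.2452147 / 0.3422123` — i.e. the U3 field ×4.4 and the B1-U anchor `0.404` ×2.0, from data already
certified; exact leaves follow the two-field node.

HONEST FRAMING: exact bookkeeping on ONE trial state (a variational CEILING moved along its own affine line in `h`); the
leaves it feeds are CONDITIONAL finite-field RESPONSE floors (claim nodes as hypotheses, CANDIDATE until readers +
referee), never order parameters, no phase word, not a superconductivity verdict. Zero compute; no definition; no named
fact; no `sorry`. References: D. Ruelle, *Statistical Mechanics: Rigorous Results* (1969) §3.3 (trial states);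
Koma–Tasaki, J. Stat. Phys. 76 (1994) 745 §1 (the sourced Hamiltonian); Griffiths, Phys. Rev. 152 (1966) 240 §II.
-/

noncomputable section

namespace Summit.Ventures.CertifiedManyBodySolver.Observables

open Matrix Literature.Probability.LatticeModels
open Literature.MathematicalPhysics.QuantumLattice Literature.MathematicalPhysics.QuantumLattice.ThermodynamicLimit
open Literature.MathematicalPhysics.QuantumLattice.TwoCluster
open scoped ComplexOrder

/-! ### §1 The open sourced box is affine in the field -/

section Affine

variable (a b : ℕ) (U μ : ℝ)

/-- **`A_C(h′) = A_C(0) + r·(A_C(h) − A_C(0))` for `h′ = r·h`**: the open sourced cluster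
`hamiltonianWith − h(P_C + P_Cᴴ)` is affine in the field. [cite: KomaTasaki1994, §1] -/
theorem dWaveSourceOpenBox_field_affine {h h' r : ℝ} (hr : h' = r * h) :
    dWaveSourceOpenBox a b U μ h' =
      dWaveSourceOpenBox a b U μ 0 + (r : ℂ) • (dWaveSourceOpenBox a b U μ h - dWaveSourceOpenBox a b U μ 0) := by
  unfold dWaveSourceOpenBox
  rw [hr]
  push_cast
  module

/-- **Real parts along the affine line**: `Re⟨ψ, A_C(h′)ψ⟩ = (1 − r)·Re⟨ψ, A_C(0)ψ⟩ + r·Re⟨ψ, A_C(h)ψ⟩` for `h′ = r·h`.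
[cite: KomaTasaki1994, §1] -/
theorem re_expect_dWaveSourceOpenBox_field {h h' r : ℝ} (hr : h' = r * h) (ψ : Fock (Orb (Fin a ×ₗ Fin b))) :
    (star ψ ⬝ᵥ (dWaveSourceOpenBox a b U μ h' *ᵥ ψ)).re =
      (1 - r) * (star ψ ⬝ᵥ (dWaveSourceOpenBox a b U μ 0 *ᵥ ψ)).re +
        r * (star ψ ⬝ᵥ (dWaveSourceOpenBox a b U μ h *ᵥ ψ)).re := by
  rw [dWaveSourceOpenBox_field_affine a b U μ hr]
  simp only [Matrix.add_mulVec, Matrix.sub_mulVec, dotProduct_add, dotProduct_sub, Matrix.smul_mulVec,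
    dotProduct_smul, smul_eq_mul, Complex.add_re, Complex.sub_re, Complex.re_ofReal_mul]
  ring

end Affine

/-! ### §2 Cap transport along the line: DOWN (interpolation) and UP (extrapolation) -/

section Caps

variable {a b : ℕ} {U μ h h' r u e0lo e0hi : ℝ} {ψ : Fock (Orb (Fin a ×ₗ Fin b))}

/-- **Reading DOWN in field** (`0 ≤ r ≤ 1`, `h′ = r·h`): the cap `Re⟨ψ, A_C(h)ψ⟩ ≤ u·(ab)` and the UPPER zero-field row
`Re⟨ψ, A_C(0)ψ⟩ ≤ e0hi·(ab)` give `Re⟨ψ, A_C(h′)ψ⟩ ≤ ((1 − r)·e0hi + r·u)·(ab)` (convex combination). [cite: Ruelle1969, §3.3] -/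
theorem clusterCap_field_down (hr : h' = r * h) (hr0 : 0 ≤ r) (hr1 : r ≤ 1)
    (hE : (star ψ ⬝ᵥ (dWaveSourceOpenBox a b U μ h *ᵥ ψ)).re ≤ u * ((a : ℝ) * b))
    (hE0 : (star ψ ⬝ᵥ (dWaveSourceOpenBox a b U μ 0 *ᵥ ψ)).re ≤ e0hi * ((a : ℝ) * b)) :
    (star ψ ⬝ᵥ (dWaveSourceOpenBox a b U μ h' *ᵥ ψ)).re ≤ ((1 - r) * e0hi + r * u) * ((a : ℝ) * b) := by
  rw [re_expect_dWaveSourceOpenBox_field a b U μ hr ψ]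
  have h1 : 0 ≤ 1 - r := sub_nonneg.2 hr1
  nlinarith [mul_le_mul_of_nonneg_left hE0 h1, mul_le_mul_of_nonneg_left hE hr0]

/-- **Reading UP in field** (`1 ≤ r`, `h′ = r·h`): the cap at `h` and the LOWER zero-field row `e0lo·(ab) ≤ Re⟨ψ, A_C(0)ψ⟩`
give `Re⟨ψ, A_C(h′)ψ⟩ ≤ ((1 − r)·e0lo + r·u)·(ab)` (`1 − r ≤ 0`). [cite: Ruelle1969, §3.3] -/
theorem clusterCap_field_up (hr : h' = r * h) (hr1 : 1 ≤ r)
    (hE : (star ψ ⬝ᵥ (dWaveSourceOpenBox a b U μ h *ᵥ ψ)).re ≤ u * ((a : ℝ) * b))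
    (hE0 : e0lo * ((a : ℝ) * b) ≤ (star ψ ⬝ᵥ (dWaveSourceOpenBox a b U μ 0 *ᵥ ψ)).re) :
    (star ψ ⬝ᵥ (dWaveSourceOpenBox a b U μ h' *ᵥ ψ)).re ≤ ((1 - r) * e0lo + r * u) * ((a : ℝ) * b) := by
  rw [re_expect_dWaveSourceOpenBox_field a b U μ hr ψ]
  have h1 : 0 ≤ r - 1 := sub_nonneg.2 hr1
  nlinarith [mul_le_mul_of_nonneg_left hE0 h1, mul_le_mul_of_nonneg_left hE (zero_le_one.trans hr1)]

end Caps

/-! ### §3 The TWO-FIELD claim node read at another field, returned in the standard node shape -/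

section Nodes

variable {a b : ℕ} (U μ : ℝ) {h h' r u nlo nhi e0lo e0hi : ℝ}

/-- **Two-field node ⇒ standard node at a SMALLER field** (`0 ≤ r ≤ 1`, `h′ = r·h`): from
`∃ ψ, parity ∧ unit ∧ E(h) ≤ u·(ab) ∧ nlo·(ab) ≤ N ∧ N ≤ nhi·(ab) ∧ e0lo·(ab) ≤ E(0) ∧ E(0) ≤ e0hi·(ab)` (the v1 conjunct
order of var-10's `gen_cert_lean.py` plus two trailing zero-field rows) to the v1 five-conjunct node at `h′` with cap
`(1 − r)·e0hi + r·u` — consumable verbatim by every existing cluster-node reader. [cite: Ruelle1969, §3.3] -/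
theorem clusterNode_at_field_down_of_twoFieldNode (hr : h' = r * h) (hr0 : 0 ≤ r) (hr1 : r ≤ 1)
    (hC : ∃ ψ : Fock (Orb (Fin a ×ₗ Fin b)), HasParity 0 ψ ∧ star ψ ⬝ᵥ ψ = 1 ∧
      (star ψ ⬝ᵥ (dWaveSourceOpenBox a b U μ h *ᵥ ψ)).re ≤ u * ((a : ℝ) * b) ∧
      nlo * ((a : ℝ) * b) ≤ (star ψ ⬝ᵥ (totalNumber *ᵥ ψ)).re ∧
      (star ψ ⬝ᵥ (totalNumber *ᵥ ψ)).re ≤ nhi * ((a : ℝ) * b) ∧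
      e0lo * ((a : ℝ) * b) ≤ (star ψ ⬝ᵥ (dWaveSourceOpenBox a b U μ 0 *ᵥ ψ)).re ∧
      (star ψ ⬝ᵥ (dWaveSourceOpenBox a b U μ 0 *ᵥ ψ)).re ≤ e0hi * ((a : ℝ) * b)) :
    ∃ ψ : Fock (Orb (Fin a ×ₗ Fin b)), HasParity 0 ψ ∧ star ψ ⬝ᵥ ψ = 1 ∧
      (star ψ ⬝ᵥ (dWaveSourceOpenBox a b U μ h' *ᵥ ψ)).re ≤ ((1 - r) * e0hi + r * u) * ((a : ℝ) * b) ∧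
      nlo * ((a : ℝ) * b) ≤ (star ψ ⬝ᵥ (totalNumber *ᵥ ψ)).re ∧
      (star ψ ⬝ᵥ (totalNumber *ᵥ ψ)).re ≤ nhi * ((a : ℝ) * b) := by
  obtain ⟨ψ, hp, h1, hE, hNlo, hNhi, -, hE0hi⟩ := hC
  exact ⟨ψ, hp, h1, clusterCap_field_down hr hr0 hr1 hE hE0hi, hNlo, hNhi⟩

/-- **Two-field node ⇒ standard node at a LARGER field** (`1 ≤ r`, `h′ = r·h`): cap `(1 − r)·e0lo + r·u` at `h′`.
[cite: Ruelle1969, §3.3] -/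
theorem clusterNode_at_field_up_of_twoFieldNode (hr : h' = r * h) (hr1 : 1 ≤ r)
    (hC : ∃ ψ : Fock (Orb (Fin a ×ₗ Fin b)), HasParity 0 ψ ∧ star ψ ⬝ᵥ ψ = 1 ∧
      (star ψ ⬝ᵥ (dWaveSourceOpenBox a b U μ h *ᵥ ψ)).re ≤ u * ((a : ℝ) * b) ∧
      nlo * ((a : ℝ) * b) ≤ (star ψ ⬝ᵥ (totalNumber *ᵥ ψ)).re ∧
      (star ψ ⬝ᵥ (totalNumber *ᵥ ψ)).re ≤ nhi * ((a : ℝ) * b) ∧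
      e0lo * ((a : ℝ) * b) ≤ (star ψ ⬝ᵥ (dWaveSourceOpenBox a b U μ 0 *ᵥ ψ)).re ∧
      (star ψ ⬝ᵥ (dWaveSourceOpenBox a b U μ 0 *ᵥ ψ)).re ≤ e0hi * ((a : ℝ) * b)) :
    ∃ ψ : Fock (Orb (Fin a ×ₗ Fin b)), HasParity 0 ψ ∧ star ψ ⬝ᵥ ψ = 1 ∧
      (star ψ ⬝ᵥ (dWaveSourceOpenBox a b U μ h' *ᵥ ψ)).re ≤ ((1 - r) * e0lo + r * u) * ((a : ℝ) * b) ∧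
      nlo * ((a : ℝ) * b) ≤ (star ψ ⬝ᵥ (totalNumber *ᵥ ψ)).re ∧
      (star ψ ⬝ᵥ (totalNumber *ᵥ ψ)).re ≤ nhi * ((a : ℝ) * b) := by
  obtain ⟨ψ, hp, h1, hE, hNlo, hNhi, hE0lo, -⟩ := hC
  exact ⟨ψ, hp, h1, clusterCap_field_up hr hr1 hE hE0lo, hNlo, hNhi⟩

/-- **The two-field node read AT its own field** (drop the zero-field rows): the v1 node. [cite: Ruelle1969, §3.3] -/
theorem clusterNode_of_twoFieldNode
    (hC : ∃ ψ : Fock (Orb (Fin a ×ₗ Fin b)), HasParity 0 ψ ∧ star ψ ⬝ᵥ ψ = 1 ∧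
      (star ψ ⬝ᵥ (dWaveSourceOpenBox a b U μ h *ᵥ ψ)).re ≤ u * ((a : ℝ) * b) ∧
      nlo * ((a : ℝ) * b) ≤ (star ψ ⬝ᵥ (totalNumber *ᵥ ψ)).re ∧
      (star ψ ⬝ᵥ (totalNumber *ᵥ ψ)).re ≤ nhi * ((a : ℝ) * b) ∧
      e0lo * ((a : ℝ) * b) ≤ (star ψ ⬝ᵥ (dWaveSourceOpenBox a b U μ 0 *ᵥ ψ)).re ∧
      (star ψ ⬝ᵥ (dWaveSourceOpenBox a b U μ 0 *ᵥ ψ)).re ≤ e0hi * ((a : ℝ) * b)) :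
    ∃ ψ : Fock (Orb (Fin a ×ₗ Fin b)), HasParity 0 ψ ∧ star ψ ⬝ᵥ ψ = 1 ∧
      (star ψ ⬝ᵥ (dWaveSourceOpenBox a b U μ h *ᵥ ψ)).re ≤ u * ((a : ℝ) * b) ∧
      nlo * ((a : ℝ) * b) ≤ (star ψ ⬝ᵥ (totalNumber *ᵥ ψ)).re ∧
      (star ψ ⬝ᵥ (totalNumber *ᵥ ψ)).re ≤ nhi * ((a : ℝ) * b) := by
  obtain ⟨ψ, hp, h1, hE, hNlo, hNhi, -, -⟩ := hC
  exact ⟨ψ, hp, h1, hE, hNlo, hNhi⟩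

end Nodes

/-! ### §4 The canonical minimiser floor at the NEW field, in one statement -/

section Floors

variable {a₁ b₁ a₂ b₂ : ℕ} {ω : InfVolFermionState 2}

/-- **Minimiser floor at a LARGER field from a two-field W5-class node (box 1, read UP at `h′ = r·h`, `1 ≤ r`) and an
exact-density `4 × 3`-class node at `h′` (box 2, pin-1 order `parity ∧ unit ∧ N = n₂·(ab) ∧ energy ≤`)**: with
`lo ≤ e(1,0,U,n)`, `nhi ≤ n < n₂` and the two end-point mixing conditions for the transported cap
`u₁′ = (1 − r)·e0lo + r·u₁`, translation-invariant density-`n` minimisers of `E_{h′}` exist and every one has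
`(lo − u)/(2h′) ≤ Re ω(P₀^d)`. CONDITIONAL on the nodes; a finite-field RESPONSE floor, not an order parameter.
[cite: Griffiths1966, §II] [cite: BratteliRobinsonI1987, Thm. 2.3.15] -/
theorem minimiser_response_floor_of_twoFieldNode_up_of_clusterNode (ha₁ : 0 < a₁) (hb₁ : 0 < b₁)
    (ha₂ : 0 < a₂) (hb₂ : 0 < b₂) {U μ₁ μ₂ h h' r lo nlo nhi n₂ n u₁ e0lo e0hi u₂ u : ℝ} (hU : 0 ≤ U)
    (hh : 0 < h') (hn0 : 0 < n) (hn2 : n < 2) (hlo : lo ≤ energyDensityTT' 1 0 U n) (hr : h' = r * h)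
    (hr1 : 1 ≤ r)
    (hC₁ : ∃ ψ : Fock (Orb (Fin a₁ ×ₗ Fin b₁)), HasParity 0 ψ ∧ star ψ ⬝ᵥ ψ = 1 ∧
      (star ψ ⬝ᵥ (dWaveSourceOpenBox a₁ b₁ U μ₁ h *ᵥ ψ)).re ≤ u₁ * ((a₁ : ℝ) * b₁) ∧
      nlo * ((a₁ : ℝ) * b₁) ≤ (star ψ ⬝ᵥ (totalNumber *ᵥ ψ)).re ∧
      (star ψ ⬝ᵥ (totalNumber *ᵥ ψ)).re ≤ nhi * ((a₁ : ℝ) * b₁) ∧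
      e0lo * ((a₁ : ℝ) * b₁) ≤ (star ψ ⬝ᵥ (dWaveSourceOpenBox a₁ b₁ U μ₁ 0 *ᵥ ψ)).re ∧
      (star ψ ⬝ᵥ (dWaveSourceOpenBox a₁ b₁ U μ₁ 0 *ᵥ ψ)).re ≤ e0hi * ((a₁ : ℝ) * b₁))
    (hC₂ : ∃ ψ : Fock (Orb (Fin a₂ ×ₗ Fin b₂)), HasParity 0 ψ ∧ star ψ ⬝ᵥ ψ = 1 ∧
      (star ψ ⬝ᵥ (totalNumber *ᵥ ψ)).re = n₂ * ((a₂ : ℝ) * b₂) ∧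
      (star ψ ⬝ᵥ (dWaveSourceOpenBox a₂ b₂ U μ₂ h' *ᵥ ψ)).re ≤ u₂ * ((a₂ : ℝ) * b₂))
    (hhi : nhi ≤ n) (hlt : n < n₂)
    (hulo : (n₂ - n) * (((1 - r) * e0lo + r * u₁) + μ₁ * nlo) + (n - nlo) * (u₂ + μ₂ * n₂) ≤ u * (n₂ - nlo))
    (huhi : (n₂ - n) * (((1 - r) * e0lo + r * u₁) + μ₁ * nhi) + (n - nhi) * (u₂ + μ₂ * n₂) ≤ u * (n₂ - nhi)) :
    (∃ ω : InfVolFermionState 2, ω.IsTranslationInvariant ∧ ω.density = n ∧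
      ∀ ω' : InfVolFermionState 2, ω'.IsTranslationInvariant → ω'.density = n →
        ω.meanEnergy (hubbardTTPrimeSourcedInteraction 1 0 U 0 dWaveFormFactor h') 1 ≤
          ω'.meanEnergy (hubbardTTPrimeSourcedInteraction 1 0 U 0 dWaveFormFactor h') 1) ∧
    ∀ ω : InfVolFermionState 2, ω.IsTranslationInvariant → ω.density = n →
      (∀ ω' : InfVolFermionState 2, ω'.IsTranslationInvariant → ω'.density = n →
        ω.meanEnergy (hubbardTTPrimeSourcedInteraction 1 0 U 0 dWaveFormFactor h') 1 ≤
          ω'.meanEnergy (hubbardTTPrimeSourcedInteraction 1 0 U 0 dWaveFormFactor h') 1) →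
      (lo - u) / (2 * h') ≤
        (ω.expect (pairRegion (insert 0 unitSteps) 0) (localPairAt (insert 0 unitSteps) dWaveFormFactor 0)).re :=
  minimiser_response_floor_of_clusterNodeInterval_of_clusterNode ha₁ hb₁ ha₂ hb₂ hU hh hn0 hn2 hlo
    (clusterNode_at_field_up_of_twoFieldNode U μ₁ hr hr1 hC₁) hC₂ hhi hlt hulo huhi

/-- **Minimiser floor at a SMALLER field** (box 1 read DOWN at `h′ = r·h`, `0 ≤ r ≤ 1`, transported cap
`(1 − r)·e0hi + r·u₁`; box 2 an exact-density node at `h′`). [cite: Griffiths1966, §II] [cite: BratteliRobinsonI1987, Thm. 2.3.15] -/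
theorem minimiser_response_floor_of_twoFieldNode_down_of_clusterNode (ha₁ : 0 < a₁) (hb₁ : 0 < b₁)
    (ha₂ : 0 < a₂) (hb₂ : 0 < b₂) {U μ₁ μ₂ h h' r lo nlo nhi n₂ n u₁ e0lo e0hi u₂ u : ℝ} (hU : 0 ≤ U)
    (hh : 0 < h') (hn0 : 0 < n) (hn2 : n < 2) (hlo : lo ≤ energyDensityTT' 1 0 U n) (hr : h' = r * h)
    (hr0 : 0 ≤ r) (hr1 : r ≤ 1)
    (hC₁ : ∃ ψ : Fock (Orb (Fin a₁ ×ₗ Fin b₁)), HasParity 0 ψ ∧ star ψ ⬝ᵥ ψ = 1 ∧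
      (star ψ ⬝ᵥ (dWaveSourceOpenBox a₁ b₁ U μ₁ h *ᵥ ψ)).re ≤ u₁ * ((a₁ : ℝ) * b₁) ∧
      nlo * ((a₁ : ℝ) * b₁) ≤ (star ψ ⬝ᵥ (totalNumber *ᵥ ψ)).re ∧
      (star ψ ⬝ᵥ (totalNumber *ᵥ ψ)).re ≤ nhi * ((a₁ : ℝ) * b₁) ∧
      e0lo * ((a₁ : ℝ) * b₁) ≤ (star ψ ⬝ᵥ (dWaveSourceOpenBox a₁ b₁ U μ₁ 0 *ᵥ ψ)).re ∧
      (star ψ ⬝ᵥ (dWaveSourceOpenBox a₁ b₁ U μ₁ 0 *ᵥ ψ)).re ≤ e0hi * ((a₁ : ℝ) * b₁))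
    (hC₂ : ∃ ψ : Fock (Orb (Fin a₂ ×ₗ Fin b₂)), HasParity 0 ψ ∧ star ψ ⬝ᵥ ψ = 1 ∧
      (star ψ ⬝ᵥ (totalNumber *ᵥ ψ)).re = n₂ * ((a₂ : ℝ) * b₂) ∧
      (star ψ ⬝ᵥ (dWaveSourceOpenBox a₂ b₂ U μ₂ h' *ᵥ ψ)).re ≤ u₂ * ((a₂ : ℝ) * b₂))
    (hhi : nhi ≤ n) (hlt : n < n₂)
    (hulo : (n₂ - n) * (((1 - r) * e0hi + r * u₁) + μ₁ * nlo) + (n - nlo) * (u₂ + μ₂ * n₂) ≤ u * (n₂ - nlo))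
    (huhi : (n₂ - n) * (((1 - r) * e0hi + r * u₁) + μ₁ * nhi) + (n - nhi) * (u₂ + μ₂ * n₂) ≤ u * (n₂ - nhi)) :
    (∃ ω : InfVolFermionState 2, ω.IsTranslationInvariant ∧ ω.density = n ∧
      ∀ ω' : InfVolFermionState 2, ω'.IsTranslationInvariant → ω'.density = n →
        ω.meanEnergy (hubbardTTPrimeSourcedInteraction 1 0 U 0 dWaveFormFactor h') 1 ≤
          ω'.meanEnergy (hubbardTTPrimeSourcedInteraction 1 0 U 0 dWaveFormFactor h') 1) ∧
    ∀ ω : InfVolFermionState 2, ω.IsTranslationInvariant → ω.density = n →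
      (∀ ω' : InfVolFermionState 2, ω'.IsTranslationInvariant → ω'.density = n →
        ω.meanEnergy (hubbardTTPrimeSourcedInteraction 1 0 U 0 dWaveFormFactor h') 1 ≤
          ω'.meanEnergy (hubbardTTPrimeSourcedInteraction 1 0 U 0 dWaveFormFactor h') 1) →
      (lo - u) / (2 * h') ≤
        (ω.expect (pairRegion (insert 0 unitSteps) 0) (localPairAt (insert 0 unitSteps) dWaveFormFactor 0)).re :=
  minimiser_response_floor_of_clusterNodeInterval_of_clusterNode ha₁ hb₁ ha₂ hb₂ hU hh hn0 hn2 hlo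
    (clusterNode_at_field_down_of_twoFieldNode U μ₁ hr hr0 hr1 hC₁) hC₂ hhi hlt hulo huhi

end Floors


/-! ### §5 The `t–t′` twin: `dWaveSourceOpenBoxTT' a b tp U μ h` is affine in the field too (A0 = `t′ = −1/4` nodes) -/

section AffineTTPrime

variable (a b : ℕ) (tp U μ : ℝ)

/-- **`A^{tt′}_C(h′) = A^{tt′}_C(0) + r·(A^{tt′}_C(h) − A^{tt′}_C(0))` for `h′ = r·h`**: the diagonal-hopping term of
`dWaveSourceOpenBoxTT'` does not depend on `h`, so the `t–t′` sourced cluster is affine in the field exactly like the `t′ = 0`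
one. [cite: XuEtAl2024, eq. (1)] [cite: KomaTasaki1994, §1] -/
theorem dWaveSourceOpenBoxTT'_field_affine {h h' r : ℝ} (hr : h' = r * h) :
    dWaveSourceOpenBoxTT' a b tp U μ h' =
      dWaveSourceOpenBoxTT' a b tp U μ 0 +
        (r : ℂ) • (dWaveSourceOpenBoxTT' a b tp U μ h - dWaveSourceOpenBoxTT' a b tp U μ 0) := by
  unfold dWaveSourceOpenBoxTT'
  rw [dWaveSourceOpenBox_field_affine a b U μ hr]
  module

/-- Real parts along the `t–t′` affine line: `Re⟨ψ, A^{tt′}_C(h′)ψ⟩ = (1 − r)·Re⟨ψ, A^{tt′}_C(0)ψ⟩ + r·Re⟨ψ, A^{tt′}_C(h)ψ⟩`.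
[cite: KomaTasaki1994, §1] -/
theorem re_expect_dWaveSourceOpenBoxTT'_field {h h' r : ℝ} (hr : h' = r * h) (ψ : Fock (Orb (Fin a ×ₗ Fin b))) :
    (star ψ ⬝ᵥ (dWaveSourceOpenBoxTT' a b tp U μ h' *ᵥ ψ)).re =
      (1 - r) * (star ψ ⬝ᵥ (dWaveSourceOpenBoxTT' a b tp U μ 0 *ᵥ ψ)).re +
        r * (star ψ ⬝ᵥ (dWaveSourceOpenBoxTT' a b tp U μ h *ᵥ ψ)).re := by
  rw [dWaveSourceOpenBoxTT'_field_affine a b tp U μ hr]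
  simp only [Matrix.add_mulVec, Matrix.sub_mulVec, dotProduct_add, dotProduct_sub, Matrix.smul_mulVec,
    dotProduct_smul, smul_eq_mul, Complex.add_re, Complex.sub_re, Complex.re_ofReal_mul]
  ring

variable {a b tp U μ} {h h' r u nlo nhi e0lo e0hi : ℝ} {ψ : Fock (Orb (Fin a ×ₗ Fin b))}

/-- **Reading DOWN in field, `t–t′` cluster** (`0 ≤ r ≤ 1`): `Re⟨ψ, A^{tt′}_C(h′)ψ⟩ ≤ ((1 − r)·e0hi + r·u)·(ab)`.
[cite: Ruelle1969, §3.3] -/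
theorem clusterCapTT'_field_down (hr : h' = r * h) (hr0 : 0 ≤ r) (hr1 : r ≤ 1)
    (hE : (star ψ ⬝ᵥ (dWaveSourceOpenBoxTT' a b tp U μ h *ᵥ ψ)).re ≤ u * ((a : ℝ) * b))
    (hE0 : (star ψ ⬝ᵥ (dWaveSourceOpenBoxTT' a b tp U μ 0 *ᵥ ψ)).re ≤ e0hi * ((a : ℝ) * b)) :
    (star ψ ⬝ᵥ (dWaveSourceOpenBoxTT' a b tp U μ h' *ᵥ ψ)).re ≤ ((1 - r) * e0hi + r * u) * ((a : ℝ) * b) := by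
  rw [re_expect_dWaveSourceOpenBoxTT'_field a b tp U μ hr ψ]
  have h1 : 0 ≤ 1 - r := sub_nonneg.2 hr1
  nlinarith [mul_le_mul_of_nonneg_left hE0 h1, mul_le_mul_of_nonneg_left hE hr0]

/-- **Reading UP in field, `t–t′` cluster** (`1 ≤ r`): `Re⟨ψ, A^{tt′}_C(h′)ψ⟩ ≤ ((1 − r)·e0lo + r·u)·(ab)`.
[cite: Ruelle1969, §3.3] -/
theorem clusterCapTT'_field_up (hr : h' = r * h) (hr1 : 1 ≤ r)
    (hE : (star ψ ⬝ᵥ (dWaveSourceOpenBoxTT' a b tp U μ h *ᵥ ψ)).re ≤ u * ((a : ℝ) * b))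
    (hE0 : e0lo * ((a : ℝ) * b) ≤ (star ψ ⬝ᵥ (dWaveSourceOpenBoxTT' a b tp U μ 0 *ᵥ ψ)).re) :
    (star ψ ⬝ᵥ (dWaveSourceOpenBoxTT' a b tp U μ h' *ᵥ ψ)).re ≤ ((1 - r) * e0lo + r * u) * ((a : ℝ) * b) := by
  rw [re_expect_dWaveSourceOpenBoxTT'_field a b tp U μ hr ψ]
  have h1 : 0 ≤ r - 1 := sub_nonneg.2 hr1
  nlinarith [mul_le_mul_of_nonneg_left hE0 h1, mul_le_mul_of_nonneg_left hE (zero_le_one.trans hr1)]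

variable (tp U μ)

/-- **Two-field `t–t′` node ⇒ standard `t–t′` node at a SMALLER field** (`0 ≤ r ≤ 1`; pin-1's capTP conjunct order with the two
trailing zero-field rows; cap `(1 − r)·e0hi + r·u`). [cite: Ruelle1969, §3.3] -/
theorem clusterNodeTT'_at_field_down_of_twoFieldNode (hr : h' = r * h) (hr0 : 0 ≤ r) (hr1 : r ≤ 1)
    (hC : ∃ ψ : Fock (Orb (Fin a ×ₗ Fin b)), HasParity 0 ψ ∧ star ψ ⬝ᵥ ψ = 1 ∧
      (star ψ ⬝ᵥ (dWaveSourceOpenBoxTT' a b tp U μ h *ᵥ ψ)).re ≤ u * ((a : ℝ) * b) ∧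
      nlo * ((a : ℝ) * b) ≤ (star ψ ⬝ᵥ (totalNumber *ᵥ ψ)).re ∧
      (star ψ ⬝ᵥ (totalNumber *ᵥ ψ)).re ≤ nhi * ((a : ℝ) * b) ∧
      e0lo * ((a : ℝ) * b) ≤ (star ψ ⬝ᵥ (dWaveSourceOpenBoxTT' a b tp U μ 0 *ᵥ ψ)).re ∧
      (star ψ ⬝ᵥ (dWaveSourceOpenBoxTT' a b tp U μ 0 *ᵥ ψ)).re ≤ e0hi * ((a : ℝ) * b)) :
    ∃ ψ : Fock (Orb (Fin a ×ₗ Fin b)), HasParity 0 ψ ∧ star ψ ⬝ᵥ ψ = 1 ∧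
      (star ψ ⬝ᵥ (dWaveSourceOpenBoxTT' a b tp U μ h' *ᵥ ψ)).re ≤ ((1 - r) * e0hi + r * u) * ((a : ℝ) * b) ∧
      nlo * ((a : ℝ) * b) ≤ (star ψ ⬝ᵥ (totalNumber *ᵥ ψ)).re ∧
      (star ψ ⬝ᵥ (totalNumber *ᵥ ψ)).re ≤ nhi * ((a : ℝ) * b) := by
  obtain ⟨ψ, hp, h1, hE, hNlo, hNhi, -, hE0hi⟩ := hC
  exact ⟨ψ, hp, h1, clusterCapTT'_field_down hr hr0 hr1 hE hE0hi, hNlo, hNhi⟩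

/-- **Two-field `t–t′` node ⇒ standard `t–t′` node at a LARGER field** (`1 ≤ r`; cap `(1 − r)·e0lo + r·u`).
[cite: Ruelle1969, §3.3] -/
theorem clusterNodeTT'_at_field_up_of_twoFieldNode (hr : h' = r * h) (hr1 : 1 ≤ r)
    (hC : ∃ ψ : Fock (Orb (Fin a ×ₗ Fin b)), HasParity 0 ψ ∧ star ψ ⬝ᵥ ψ = 1 ∧
      (star ψ ⬝ᵥ (dWaveSourceOpenBoxTT' a b tp U μ h *ᵥ ψ)).re ≤ u * ((a : ℝ) * b) ∧
      nlo * ((a : ℝ) * b) ≤ (star ψ ⬝ᵥ (totalNumber *ᵥ ψ)).re ∧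
      (star ψ ⬝ᵥ (totalNumber *ᵥ ψ)).re ≤ nhi * ((a : ℝ) * b) ∧
      e0lo * ((a : ℝ) * b) ≤ (star ψ ⬝ᵥ (dWaveSourceOpenBoxTT' a b tp U μ 0 *ᵥ ψ)).re ∧
      (star ψ ⬝ᵥ (dWaveSourceOpenBoxTT' a b tp U μ 0 *ᵥ ψ)).re ≤ e0hi * ((a : ℝ) * b)) :
    ∃ ψ : Fock (Orb (Fin a ×ₗ Fin b)), HasParity 0 ψ ∧ star ψ ⬝ᵥ ψ = 1 ∧
      (star ψ ⬝ᵥ (dWaveSourceOpenBoxTT' a b tp U μ h' *ᵥ ψ)).re ≤ ((1 - r) * e0lo + r * u) * ((a : ℝ) * b) ∧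
      nlo * ((a : ℝ) * b) ≤ (star ψ ⬝ᵥ (totalNumber *ᵥ ψ)).re ∧
      (star ψ ⬝ᵥ (totalNumber *ᵥ ψ)).re ≤ nhi * ((a : ℝ) * b) := by
  obtain ⟨ψ, hp, h1, hE, hNlo, hNhi, hE0lo, -⟩ := hC
  exact ⟨ψ, hp, h1, clusterCapTT'_field_up hr hr1 hE hE0lo, hNlo, hNhi⟩

end AffineTTPrime

end Summit.Ventures.CertifiedManyBodySolver.Observables

end
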